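import Summits.CriticalPhenomena.SAWScalingLimit.Theorems.CriticalBubbleBound.Negative.CriticalBubbleBoundConstantBound
import Summits.CriticalPhenomena.SAWScalingLimit.Theorems.CriticalBubbleBound.Negative.CriticalBubbleBoundOneNumber
import Summits.CriticalPhenomena.SAWScalingLimit.Theorems.CriticalBubbleBound.Negative.CriticalBubbleBoundSufficient
import Literature.Barriers.CriticalPhenomena.SAPCanonical

/-!
# Negative-side results for the crux `SAWTotalPositivity.CriticalBubbleBound` (stmt-CriticalPhenomena-7117):
the POLYGON normal form (work-file §18)

`criticalBubbleBound_iff_polygonSeries_ne_top : CriticalBubbleBound ↔ Σ_N N · q_N · x_c^N < ∞`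
(`q_N = Literature.Barriers.CriticalPhenomena.isotropicPolygonCount N`, the `N`-step self-avoiding
polygons of `ℤ²` up to translation), through the exact identity
`two_mul_criticalFugacity_mul_bubble_e₀ : 2 x_c G_{x_c}(0,e₀) = 2 x_c² + Σ_N N q_N x_c^N`, i.e.
`G_{x_c}(0,e₀) = x_c + Σ_N (N/2) q_N x_c^{N-1}` — Madras–Slade's `2N q_N = Σ_{e∼0} c_{N-1}(0,e)`
(`sum_countAt_eq_mul_isotropicPolygonCount`, from the tree's canonical-word count
`rootedPolygonCount = 2N · polygonCount` plus the parity/partition lemma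
`sum_rootedPolygonCount_eq`). So the crux is verbatim "`θ > 2` summably" for `q_N = N^{-θ_N} μ^N`
(truth `θ = 5/2`; in print `θ_N ≥ 3/2 - δ` on a density-one set, Hammond 2018): the common starting
point of every ideator card, now importable; and the typed form of the warning (work-file §9a) that
the BULK bubble carries the multiplicity factor `N` that no boundary bubble has.

Refuter `cdisprove` (standing adversary, gen 4); the full indexed work file is
`Summits/CriticalPhenomena/SAWScalingLimit/Cruxes/CriticalBubbleBound/Disproof.lean` (§18).
-/

noncomputable section

open MeasureTheory Filter Topology Set Function
open Literature.Probability.LatticeModels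
open Literature.Probability.RandomPlanarGeometry Literature.Probability.RandomPlanarGeometry.SAW
open scoped ENNReal NNReal BigOperators

namespace Summit.CriticalPhenomena.SAWScalingLimit.Theorems.CriticalBubbleBound.Negative

open Summit.CriticalPhenomena.SAWScalingLimit.Theses.SAWTotalPositivity (CriticalBubbleBound)
open Literature.Barriers.CriticalPhenomena (horizontalSteps rootedPolygonCount polygonCount
  isotropicPolygonCount)
open Literature.Barriers.CriticalPhenomena.Haruspicy (rootedPolygonCount_eq_card_sapWords
  card_sapWords_eq polygonCount_eq_card_canonWords)

/-! ## §18 The POLYGON normal form: `G_{x_c}(0,e₀) = x_c + Σ_N (N/2) q_N x_c^{N-1}` -/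

/-- **Exact re-rooting count** `2N · p_{m,n} = rootedPolygonCount m n` (`N = 2(m+n)`): the
tree's `polygonCount` (defined by integer division) loses nothing — every polygon class has
exactly `2N` rooted oriented representatives (Madras–Slade (3.2.1), via the canonical words of
`SAPCanonical`). [cite: MadrasSlade1993, Definition 3.2.2, eq. (3.2.1)] -/
theorem rootedPolygonCount_eq_mul_polygonCount (m n : ℕ) :
    rootedPolygonCount m n = 2 * (2 * (m + n)) * polygonCount m n := by
  rw [rootedPolygonCount_eq_card_sapWords, card_sapWords_eq, polygonCount_eq_card_canonWords]

/-- Parity of the horizontal step count of a lattice walk: `#horizontal steps ≡ v₀ - u₀ (mod 2)`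
(each horizontal step changes the abscissa by `±1`, each vertical step by `0`). [folklore] -/
theorem horizontalSteps_parity {u v : Site 2} (p : (zdGraph 2).Walk u v) :
    Even ((horizontalSteps p : ℤ) - (v 0 - u 0)) := by
  induction p with
  | nil => simp [horizontalSteps]
  | cons hadj q ih =>
    rename_i a b c
    have hq : horizontalSteps q = q.darts.countP fun e => e.fst 1 = e.snd 1 := rfl
    have hcons : horizontalSteps (SimpleGraph.Walk.cons hadj q) =
        horizontalSteps q + (if a 1 = b 1 then 1 else 0) := by
      rw [horizontalSteps, SimpleGraph.Walk.darts_cons, List.countP_cons, ← hq]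
      congr 1
      by_cases hab : a 1 = b 1 <;> simp [hab]
    rw [hcons]
    obtain ⟨i, h | h⟩ := (zdGraph_adj_iff _ _).1 hadj
    · fin_cases i
      · have hb0 : b 0 = a 0 + 1 := by subst h; simp
        have hb1 : b 1 = a 1 := by subst h; simp
        rw [if_pos hb1.symm]
        have : ((horizontalSteps q + 1 : ℕ) : ℤ) - (c 0 - a 0) =
            ((horizontalSteps q : ℤ) - (c 0 - b 0)) := by push_cast; rw [hb0]; ring
        rw [this]; exact ih
      · have hb0 : b 0 = a 0 := by subst h; simp
        have hb1 : b 1 = a 1 + 1 := by subst h; simp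
        rw [if_neg (by rw [hb1]; omega)]
        have : ((horizontalSteps q + 0 : ℕ) : ℤ) - (c 0 - a 0) =
            ((horizontalSteps q : ℤ) - (c 0 - b 0)) := by push_cast; rw [hb0]; ring
        rw [this]; exact ih
    · fin_cases i
      · have hb0 : a 0 = b 0 + 1 := by subst h; simp
        have hb1 : a 1 = b 1 := by subst h; simp
        rw [if_pos hb1]
        have : ((horizontalSteps q + 1 : ℕ) : ℤ) - (c 0 - a 0) =
            ((horizontalSteps q : ℤ) - (c 0 - b 0)) + 2 := by push_cast; rw [hb0]; ring
        rw [this]; exact ih.add (by decide)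
      · have hb0 : a 0 = b 0 := by subst h; simp
        have hb1 : a 1 = b 1 + 1 := by subst h; simp
        rw [if_neg (by rw [hb1]; omega)]
        have : ((horizontalSteps q + 0 : ℕ) : ℤ) - (c 0 - a 0) =
            ((horizontalSteps q : ℤ) - (c 0 - b 0)) := by push_cast; rw [hb0]; ring
        rw [this]; exact ih

/-- `#horizontal steps ≤ |p|`. [folklore] -/
theorem horizontalSteps_le_length {u v : Site 2} (p : (zdGraph 2).Walk u v) :
    horizontalSteps p ≤ p.length := by
  rw [horizontalSteps, ← SimpleGraph.Walk.length_darts]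
  exact List.countP_le_length

/-- For a neighbour `e` of `0`: the closing-bond indicator `[e₁ = 0]` has the parity of `e₀`. [folklore] -/
theorem ind_parity_of_adj_zero {e : Site 2} (he : (zdGraph 2).Adj 0 e) :
    Even ((if e 1 = 0 then 1 else 0 : ℕ) - (e 0 : ℤ)) := by
  obtain ⟨i, h | h⟩ := (zdGraph_adj_iff _ _).1 he
  · rw [zero_add] at h
    subst h
    fin_cases i <;> simp
  · have : e = -Pi.single i 1 := eq_neg_of_add_eq_zero_left h.symm
    subst this
    fin_cases i <;> simp

/-- **Every closed-up SAW is counted once**: for `K ≥ 2`,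
`Σ_{m ≤ K} rootedPolygonCount m (K-m) = Σ_{e ∼ 0} c_{2K-1}(0,e)` — the horizontal-bond classes
partition the `(2K-1)`-step SAWs from `0` to the neighbours of `0` (the bond count of the closed
polygon is even and at most `2K`). [cite: MadrasSlade1993, §3.2, eq. (3.2.1)] -/
theorem sum_rootedPolygonCount_eq (K : ℕ) (hK : 2 ≤ K) :
    ∑ m ∈ Finset.range (K + 1), rootedPolygonCount m (K - m) =
      ∑ e ∈ (zdGraph 2).neighborFinset 0, Zd.countAt 2 (2 * K - 1) e := by
  classical
  have h1 : ∀ m ∈ Finset.range (K + 1), rootedPolygonCount m (K - m) =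
      ∑ e ∈ (zdGraph 2).neighborFinset 0,
        (((zdGraph 2).finsetWalkLength (2 * K - 1) (0 : Site 2) e).filter
          fun p => p.IsPath ∧ horizontalSteps p + (if e 1 = 0 then 1 else 0) = 2 * m).card := by
    intro m hm
    rw [Finset.mem_range] at hm
    have hmK : m + (K - m) = K := by omega
    rw [rootedPolygonCount, hmK, if_neg (by omega)]
  rw [Finset.sum_congr rfl h1, Finset.sum_comm]
  refine Finset.sum_congr rfl fun e he => ?_
  rw [SimpleGraph.mem_neighborFinset] at he
  set c : ℕ := if e 1 = 0 then 1 else 0 with hc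
  set S := (zdGraph 2).finsetWalkLength (2 * K - 1) (0 : Site 2) e with hS
  have hct : Zd.countAt 2 (2 * K - 1) e = (S.filter fun p => p.IsPath).card := by
    rw [Zd.countAt]
  rw [hct, Finset.card_eq_sum_card_fiberwise (f := fun p => (horizontalSteps p + c) / 2)
    (t := Finset.range (K + 1)) ?_]
  · refine Finset.sum_congr rfl fun m _ => ?_
    rw [Finset.filter_filter]
    congr 1
    apply Finset.filter_congr
    intro p hp
    rw [hS, SimpleGraph.mem_finsetWalkLength_iff] at hp
    have hev : Even ((horizontalSteps p : ℤ) + c) := by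
      have h1 := horizontalSteps_parity p
      have h2 := ind_parity_of_adj_zero he
      simp only [Pi.zero_apply, sub_zero] at h1
      have := (h1.add h2).add (even_two_mul (e 0))
      rw [hc]
      have key : (horizontalSteps p : ℤ) + ((if e 1 = 0 then 1 else 0 : ℕ) : ℕ) =
          (horizontalSteps p : ℤ) - e 0 + (((if e 1 = 0 then 1 else 0 : ℕ) : ℕ) - e 0) + 2 * e 0 := by
        ring
      rw [key]
      exact this
    obtain ⟨k, hk⟩ := hev
    constructor
    · rintro ⟨hpath, hm⟩
      exact ⟨hpath, by omega⟩
    · rintro ⟨hpath, hm⟩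
      exact ⟨hpath, by omega⟩
  · intro p hp
    rw [Finset.mem_coe, Finset.mem_filter, hS, SimpleGraph.mem_finsetWalkLength_iff] at hp
    show (horizontalSteps p + c) / 2 ∈ (↑(Finset.range (K + 1)) : Set ℕ)
    rw [Finset.mem_coe, Finset.mem_range]
    have h1 := horizontalSteps_le_length p
    have h2 : c ≤ 1 := by rw [hc]; split_ifs <;> omega
    omega

/-- **Rooted loops are `2N` times the polygons**: for `K ≥ 2`,
`Σ_{e ∼ 0} c_{2K-1}(0,e) = 2 · (2K) · q_{2K}` (`q_N = isotropicPolygonCount N`, the number of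
`N`-step self-avoiding polygons up to translation). [cite: MadrasSlade1993, §3.2, eq. (3.2.1)] -/
theorem sum_countAt_eq_mul_isotropicPolygonCount (K : ℕ) (hK : 2 ≤ K) :
    ∑ e ∈ (zdGraph 2).neighborFinset 0, Zd.countAt 2 (2 * K - 1) e =
      2 * (2 * K) * isotropicPolygonCount (2 * K) := by
  rw [← sum_rootedPolygonCount_eq K hK, isotropicPolygonCount, if_pos (even_two_mul K),
    show 2 * K / 2 = K by omega, Finset.mul_sum]
  refine Finset.sum_congr rfl fun m hm => ?_
  rw [Finset.mem_range] at hm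
  rw [rootedPolygonCount_eq_mul_polygonCount, show m + (K - m) = K by omega]

/-- SAWs from `0` to a NEIGHBOUR of `0` have odd length: `c_n(0,e) = 0` for even `n`. [folklore] -/
theorem countAt_eq_zero_of_even_of_adj {n : ℕ} (hn : Even n) {e : Site 2}
    (he : (zdGraph 2).Adj 0 e) : Zd.countAt 2 n e = 0 := by
  classical
  rw [← Zd.card_sawWalksAt, Finset.card_eq_zero, Finset.eq_empty_iff_forall_notMem]
  intro p hp
  have hlen : p.length = n := (Zd.mem_sawWalksAt.1 hp).2
  have hpar : Even ((e 0 + e 1) - ((0 : Site 2) 0 + (0 : Site 2) 1) - (p.length : ℤ)) := walk_parity p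
  have h1 : Even ((e 0 + e 1 : ℤ) - 1) := by
    obtain ⟨i, h | h⟩ := (zdGraph_adj_iff _ _).1 he
    · rw [zero_add] at h
      subst h
      fin_cases i <;> simp
    · have : e = -Pi.single i 1 := eq_neg_of_add_eq_zero_left h.symm
      subst this
      fin_cases i <;> simp
  have h0 : ((0 : Site 2) 0 + (0 : Site 2) 1 : ℤ) = 0 := by simp
  rw [h0, hlen] at hpar
  obtain ⟨k, hk⟩ := hn
  obtain ⟨j, hj⟩ := hpar
  obtain ⟨l, hl⟩ := h1
  omega

/-- The one-step walk: `c_1(0,e) = 1` for `e ∼ 0`. [folklore] -/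
theorem countAt_one_of_adj {e : Site 2} (he : (zdGraph 2).Adj 0 e) : Zd.countAt 2 1 e = 1 := by
  classical
  rw [Zd.countAt, Finset.card_eq_one]
  refine ⟨SimpleGraph.Walk.cons he SimpleGraph.Walk.nil, ?_⟩
  ext p
  rw [Finset.mem_filter, SimpleGraph.mem_finsetWalkLength_iff, Finset.mem_singleton]
  constructor
  · rintro ⟨hl, -⟩
    cases p with
    | nil => simp at hl
    | cons h q =>
      rename_i b
      rw [SimpleGraph.Walk.length_cons] at hl
      have hq : q.length = 0 := by omega
      have hb : b = e := SimpleGraph.Walk.eq_of_length_eq_zero hq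
      subst hb
      rw [SimpleGraph.Walk.length_eq_zero_iff] at hq
      cases hq
      rfl
  · rintro rfl
    exact ⟨rfl, by simp [SimpleGraph.Walk.cons_isPath_iff, he.ne]⟩

/-- The origin of `ℤ²` has `4` neighbours, so `Σ_{e ∼ 0} c_1(0,e) = 4`. [folklore] -/
theorem sum_countAt_one : ∑ e ∈ (zdGraph 2).neighborFinset 0, Zd.countAt 2 1 e = 4 := by
  rw [Finset.sum_congr rfl fun e he => countAt_one_of_adj ((SimpleGraph.mem_neighborFinset _ _ _).1 he),
    Finset.sum_const, smul_eq_mul, mul_one]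
  exact card_neighborFinset_zdGraph_holds (d := 2) 0

/-! ### The series identity `x_c · Σ_{e∼0} G_{x_c}(0,e) = 4 x_c² + 2 Σ_N N q_N x_c^N` -/

/-- **`T := Σ_N N · q_N · x_c^N ∈ [0,∞]`** — the critical polygon mass rooted at a VERTEX
(`q_N = isotropicPolygonCount N` = `N`-step self-avoiding polygons of `ℤ²` up to translation;
with `q_N = N^{-θ_N} μ^N` this is `Σ_N N^{1-θ_N}`). The common normal form of the ideators'
cards ("`Σ_N N p_N μ^{-N} < ∞`", "`θ > 2` with a summable margin"). [cite: MadrasSlade1993, §1.4 and eq. (3.2.1)] -/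
def polygonSeries : ℝ≥0∞ :=
  ∑' N : ℕ, ((N * isotropicPolygonCount N : ℕ) : ℝ≥0∞) * ENNReal.ofReal (criticalFugacity ^ N)

/-- The sum of the four critical bubbles as ONE length series with the rooted-loop counts
`a_n := Σ_{e ∼ 0} c_n(0,e)`. [folklore] -/
theorem sum_bubble_eq_tsum :
    ∑ e ∈ (zdGraph 2).neighborFinset 0, bubble e =
      ∑' n : ℕ, ((∑ e ∈ (zdGraph 2).neighborFinset 0, Zd.countAt 2 n e : ℕ) : ℝ≥0∞) *
        ENNReal.ofReal (criticalFugacity ^ n) := by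
  simp_rw [bubble, latticeKernel_zero_eq_tsum_countAt]
  rw [← Summable.tsum_finsetSum (fun _ _ => ENNReal.summable)]
  refine tsum_congr fun n => ?_
  rw [Nat.cast_sum, Finset.sum_mul]

/-- Even lengths carry no loops: `a_{2K} = 0`. [folklore] -/
theorem loopCount_even (K : ℕ) : ∑ e ∈ (zdGraph 2).neighborFinset 0, Zd.countAt 2 (2 * K) e = 0 :=
  Finset.sum_eq_zero fun _ he => countAt_eq_zero_of_even_of_adj (even_two_mul K)
    ((SimpleGraph.mem_neighborFinset _ _ _).1 he)

/-- Odd lengths `≥ 3`: `a_{2K+3} = 2 (2K+4) q_{2K+4}`. [cite: MadrasSlade1993, §3.2, eq. (3.2.1)] -/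
theorem loopCount_odd (K : ℕ) : ∑ e ∈ (zdGraph 2).neighborFinset 0, Zd.countAt 2 (2 * K + 3) e =
    2 * (2 * K + 4) * isotropicPolygonCount (2 * K + 4) := by
  have h := sum_countAt_eq_mul_isotropicPolygonCount (K + 2) (by omega)
  rw [show 2 * (K + 2) - 1 = 2 * K + 3 by omega, show 2 * (K + 2) = 2 * K + 4 by ring] at h
  exact h

/-- `q_2 = 0` (no polygon has two bonds). [folklore] -/
theorem isotropicPolygonCount_two : isotropicPolygonCount 2 = 0 := by
  rw [isotropicPolygonCount, if_pos (by decide), show 2 / 2 = 1 from rfl, Finset.sum_eq_zero]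
  intro m hm
  rw [Finset.mem_range] at hm
  rw [polygonCount, rootedPolygonCount, if_pos (by omega), Nat.zero_div]

/-- `q_N = 0` for odd `N`. [folklore] -/
theorem isotropicPolygonCount_odd (K : ℕ) : isotropicPolygonCount (2 * K + 1) = 0 := by
  rw [isotropicPolygonCount, if_neg]
  rw [Nat.not_even_iff_odd]
  exact odd_two_mul_add_one K

/-- **THE LOOP/POLYGON IDENTITY**: `x_c · Σ_{e ∼ 0} G_{x_c}(0,e) = 4 x_c² + 2 T`, i.e. (§10, all
four bubbles equal) `G_{x_c}(0,e₀) = x_c + Σ_N (N/2) q_N x_c^{N-1}`: the one-step walk, plus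
the polygons through the root edge counted with multiplicity `N/2` = (number of edges of the
polygon parallel to `e₀`, on average over the quarter turn). This is the typed form of §9a(1):
the difference between the BULK bubble and any boundary bubble is exactly the factor `N`
(where along the polygon the root edge sits). [cite: MadrasSlade1993, §3.2, eq. (3.2.1)] -/
theorem criticalFugacity_mul_sum_bubble :
    ENNReal.ofReal criticalFugacity * ∑ e ∈ (zdGraph 2).neighborFinset 0, bubble e =
      4 * ENNReal.ofReal (criticalFugacity ^ 2) + 2 * polygonSeries := by
  set x := criticalFugacity with hx
  have hx0 : 0 ≤ x := criticalFugacity_pos_lt_one'.1.le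
  set X : ℕ → ℝ≥0∞ := fun n => ENNReal.ofReal (x ^ n) with hX
  have hXmul : ∀ n, ENNReal.ofReal x * X n = X (n + 1) := fun n => by
    simp only [hX]
    rw [← ENNReal.ofReal_mul hx0, pow_succ, mul_comm]
  set a : ℕ → ℕ := fun n => ∑ e ∈ (zdGraph 2).neighborFinset 0, Zd.countAt 2 n e with ha
  have hS : ∑ e ∈ (zdGraph 2).neighborFinset 0, bubble e = ∑' n, (a n : ℝ≥0∞) * X n :=
    sum_bubble_eq_tsum
  have hS2 : ∑' n, (a n : ℝ≥0∞) * X n = 4 * X 1 + ∑' K, (a (2 * K + 3) : ℝ≥0∞) * X (2 * K + 3) := by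
    rw [← tsum_even_add_odd (f := fun n => (a n : ℝ≥0∞) * X n) ENNReal.summable ENNReal.summable]
    have heven : ∀ K, (a (2 * K) : ℝ≥0∞) * X (2 * K) = 0 := fun K => by
      rw [show a (2 * K) = 0 from loopCount_even K]
      simp
    simp only [heven, tsum_zero, zero_add]
    rw [tsum_eq_zero_add' ENNReal.summable]
    congr 1
    rw [show a (2 * 0 + 1) = 4 from sum_countAt_one]
    simp
  have hP : polygonSeries =
      ∑' K, (((2 * K + 4) * isotropicPolygonCount (2 * K + 4) : ℕ) : ℝ≥0∞) * X (2 * K + 4) := by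
    rw [polygonSeries]
    change ∑' N, ((N * isotropicPolygonCount N : ℕ) : ℝ≥0∞) * X N = _
    rw [← tsum_even_add_odd (f := fun N => ((N * isotropicPolygonCount N : ℕ) : ℝ≥0∞) * X N)
      ENNReal.summable ENNReal.summable]
    have hodd : ∀ K, (((2 * K + 1) * isotropicPolygonCount (2 * K + 1) : ℕ) : ℝ≥0∞) * X (2 * K + 1) = 0 :=
      fun K => by rw [isotropicPolygonCount_odd]; simp
    simp only [hodd, tsum_zero, add_zero]
    rw [tsum_eq_zero_add' ENNReal.summable, tsum_eq_zero_add' ENNReal.summable]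
    have h0 : (((2 * 0) * isotropicPolygonCount (2 * 0) : ℕ) : ℝ≥0∞) * X (2 * 0) = 0 := by simp
    have h1 : (((2 * (0 + 1)) * isotropicPolygonCount (2 * (0 + 1)) : ℕ) : ℝ≥0∞) * X (2 * (0 + 1)) = 0 := by
      rw [show 2 * (0 + 1) = 2 by rfl, isotropicPolygonCount_two]
      simp
    rw [h0, h1, zero_add, zero_add]
    refine tsum_congr fun K => ?_
    rw [show 2 * (K + 1 + 1) = 2 * K + 4 by ring]
  -- assemble
  rw [hS, hS2, mul_add, ← ENNReal.tsum_mul_left, hP, ← ENNReal.tsum_mul_left]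
  congr 1
  · rw [← mul_assoc, mul_comm (ENNReal.ofReal x) 4, mul_assoc, hXmul 1]
  · refine tsum_congr fun K => ?_
    rw [← mul_assoc, mul_comm (ENNReal.ofReal x), mul_assoc, hXmul,
      show a (2 * K + 3) = 2 * (2 * K + 4) * isotropicPolygonCount (2 * K + 4) from loopCount_odd K,
      show 2 * K + 3 + 1 = 2 * K + 4 by ring]
    push_cast
    ring

/-- **POLYGON NORMAL FORM OF THE CRUX**: `CriticalBubbleBound ⟺ Σ_N N q_N x_c^N < ∞` —
finiteness of the critical polygon mass rooted at a vertex, i.e. "`θ > 2` summably" for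
`q_N = N^{-θ_N} μ^N` (truth `θ = 5/2`; proved: `θ_N ≥ 3/2 - δ` on a density-one set, Hammond
2018). Every ideator card for this crux starts here. [cite: MadrasSlade1993, §1.4, eq. (1.4.13) and eq. (3.2.1)] -/
theorem criticalBubbleBound_iff_polygonSeries_ne_top : CriticalBubbleBound ↔ polygonSeries ≠ ⊤ := by
  rw [criticalBubbleBound_iff_bubble_ne_top]
  have hid := criticalFugacity_mul_sum_bubble
  have hx0 : ENNReal.ofReal criticalFugacity ≠ 0 :=
    (ENNReal.ofReal_pos.2 criticalFugacity_pos_lt_one'.1).ne'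
  constructor
  · intro h hP
    have hS : ∑ e ∈ (zdGraph 2).neighborFinset 0, bubble e ≠ ⊤ :=
      ENNReal.sum_ne_top.2 fun e he => h e ((SimpleGraph.mem_neighborFinset _ _ _).1 he)
    have hfin : ENNReal.ofReal criticalFugacity * ∑ e ∈ (zdGraph 2).neighborFinset 0, bubble e ≠ ⊤ :=
      ENNReal.mul_ne_top ENNReal.ofReal_ne_top hS
    rw [hid, hP, ENNReal.mul_top two_ne_zero] at hfin
    exact hfin (by simp)
  · intro hP e he
    have hfin : 4 * ENNReal.ofReal (criticalFugacity ^ 2) + 2 * polygonSeries ≠ ⊤ :=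
      ENNReal.add_ne_top.2 ⟨ENNReal.mul_ne_top (by simp) ENNReal.ofReal_ne_top,
        ENNReal.mul_ne_top (by simp) hP⟩
    rw [← hid] at hfin
    have hS : ∑ e ∈ (zdGraph 2).neighborFinset 0, bubble e ≠ ⊤ := by
      intro htop
      rw [htop, ENNReal.mul_top hx0] at hfin
      exact hfin rfl
    exact ne_top_of_le_ne_top hS (Finset.single_le_sum (f := bubble) (fun _ _ => zero_le)
      ((SimpleGraph.mem_neighborFinset _ _ _).2 he))

/-- **THE BUBBLE AS A POLYGON SERIES**: `2 x_c · G_{x_c}(0,e₀) = 2 x_c² + Σ_N N q_N x_c^N`, i.e.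
`G_{x_c}(0,e₀) = x_c + Σ_N (N/2) q_N x_c^{N-1}` (numerically `≈ 0.379 + 0.43 ≈ 0.81`, §8).
[cite: MadrasSlade1993, §3.2, eq. (3.2.1)] -/
theorem two_mul_criticalFugacity_mul_bubble_e₀ :
    2 * (ENNReal.ofReal criticalFugacity * bubble e₀) =
      2 * ENNReal.ofReal (criticalFugacity ^ 2) + polygonSeries := by
  have hid := criticalFugacity_mul_sum_bubble
  have hsum : ∑ e ∈ (zdGraph 2).neighborFinset 0, bubble e = 4 * bubble e₀ := by
    rw [Finset.sum_congr rfl fun e he => bubble_eq_bubble_e₀ ((SimpleGraph.mem_neighborFinset _ _ _).1 he),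
      Finset.sum_const, card_neighborFinset_zdGraph_holds (d := 2) 0, nsmul_eq_mul]
    norm_num
  rw [hsum] at hid
  have h4 : ENNReal.ofReal criticalFugacity * (4 * bubble e₀) = 2 * (2 * (ENNReal.ofReal criticalFugacity * bubble e₀)) := by
    ring
  have h4' : 4 * ENNReal.ofReal (criticalFugacity ^ 2) + 2 * polygonSeries =
      2 * (2 * ENNReal.ofReal (criticalFugacity ^ 2) + polygonSeries) := by ring
  rw [h4, h4'] at hid
  exact (ENNReal.mul_right_inj two_ne_zero ENNReal.ofNat_ne_top).1 hid

end Summit.CriticalPhenomena.SAWScalingLimit.Theorems.CriticalBubbleBound.Negative
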